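import Summits.RiemannHypothesis.RiemannHypothesis.Theorems.WeilFormatCCinfArchMonomials
import Summits.RiemannHypothesis.RiemannHypothesis.Theorems.WeilFormatCArchNodeSumExpansion
import Summits.RiemannHypothesis.RiemannHypothesis.Theorems.WeilFormatCPolyWindowEntryBox
import HarnessLib

/-!
# Format C, design C∞ (E2, data side): kernel box for the IMAGE REMAINDER constant `ρ_re(q, m₀)` (even sector)

Route context: Fourier–Galerkin / Schur-complement certificates of Weil positivity on a window ("format C", C∞ door;
cell memo `run/shared/lean/pub/rh-explicit/rh-explicit-weil-2/gen15/E2-PLAN-v2.md` §5; supporting stmt-RiemannHypothesis-0098;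
seat rh-explicit-weil-2).  `abs_re_image_pow_sub_collected_le` (weil-10) bounds the image truncation by
`(1/√(2a))·(|4C_q s|·qq^{J+1}/m₀^{2J+2} + Σ_{k≤q} q^{(k)}(a/(πm₀))^{k+1}(|α_k|·remC(m₀) + |β_k|·remS(m₀)))`,
`α_k = (a^{q−k} − (−a)^{q−k})Re(i^{k+1})`, `β_k = (a^{q−k} + (−a)^{q−k})Im(i^{k+1})`.  This file boxes that number from INPUT
boxes `Rs ∋ 1/√(2a)`, `Pol ∋ 4C_q s`, `QQ ∋ a²/(4π²)`, `AP ∋ a/π`, `RemC ∋ remC(m₀)`, `RemS ∋ remS(m₀)` (`CinfCoeff.remCBox`,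
`remSBox`): `CinfCoeff.imgRemBox`, `mem_imgRemBox` (verbatim expression).  Interval plumbing only; standard axioms; no RH claim.
-/

set_option autoImplicit false
-- `Summit.RiemannHypothesis.RiemannHypothesis.…` is the layout-mandated namespace (summit = problem name).
set_option linter.dupNamespace false

open Finset Complex MeasureTheory Set
open scoped Real

namespace Summit.RiemannHypothesis.RiemannHypothesis.Theorems.WeilFormatC

open Literature.NumberTheory.LFunctions Literature.Analysis.SpecialFunctions
open Literature.Analysis.ValidatedNumerics Literature.Analysis.ValidatedNumerics.NumericsMP

namespace CinfCoeff

open WinConst (ratBox mem_ratBox mulRatBox mem_mulRatBox)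
open WinEntry (sumBox mem_sumBox)

variable {S : ℕ}

/-- `x^n` by repeated outward multiplication (local copy). -/
def powJ (S : ℕ) (X : MI) : ℕ → MI
  | 0 => MI.ofInt S 1
  | n + 1 => (powJ S X n).mul S X

/-- `powJ ∋ x^n`. -/
theorem mem_powJ (hS : 0 < S) {x : ℝ} {X : MI} (hx : MI.mem S x X) : ∀ n : ℕ, MI.mem S (x ^ n) (powJ S X n)
  | 0 => by simpa [powJ] using MI.mem_ofInt S 1
  | n + 1 => by rw [pow_succ, powJ]; exact MI.mem_mul hS (mem_powJ hS hx n) hx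

/-- Absolute-value box: `|x| ∈ [0 ∨ lo ∨ −hi, max |lo| |hi|]`. -/
def absBox (I : MI) : MI := ⟨max 0 (max I.lo (-I.hi)), max |I.lo| |I.hi|⟩

/-- `absBox ∋ |x|`. -/
theorem mem_absBox {x : ℝ} {I : MI} (hx : MI.mem S x I) : MI.mem S |x| (absBox I) := by
  obtain ⟨h1, h2⟩ := hx
  have hSn : (0 : ℝ) ≤ (S : ℝ) := by positivity
  have e : |x| * (S : ℝ) = |x * S| := by rw [abs_mul, abs_of_nonneg hSn]
  unfold absBox
  constructor
  · rw [e]; push_cast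
    refine max_le (abs_nonneg _) (max_le (h1.trans (le_abs_self _)) ?_)
    linarith [neg_le_abs (x * (S : ℝ))]
  · rw [e]; push_cast
    exact abs_le_max_abs_abs h1 h2

/-- `|α_k| = |(a^{q−k} − (−a)^{q−k}) Re(i^{k+1})|` and `|β_k|` as rationals (`Re/Im(i^n) ∈ {0, ±1}`). -/
def absAlphaQ (a : ℚ) (q k : ℕ) : ℚ :=
  |(a ^ (q - k) - (-a) ^ (q - k)) * (if (k + 1) % 4 = 0 then 1 else if (k + 1) % 4 = 2 then -1 else 0)|

/-- `|β_k|` as a rational. -/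
def absBetaQ (a : ℚ) (q k : ℕ) : ℚ :=
  |(a ^ (q - k) + (-a) ^ (q - k)) * (if (k + 1) % 4 = 1 then 1 else if (k + 1) % 4 = 3 then -1 else 0)|

/-- `Re(i^n)` as the rational pattern. -/
theorem re_I_pow_eq (n : ℕ) : (I ^ n).re = ((if n % 4 = 0 then (1 : ℚ) else if n % 4 = 2 then -1 else 0 : ℚ) : ℝ) := by
  rw [I_pow_eq_I_pow_mod_four n]
  have h4 : n % 4 < 4 := Nat.mod_lt _ (by norm_num)
  interval_cases hn : n % 4 <;> simp [pow_succ]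

/-- `Im(i^n)` as the rational pattern. -/
theorem im_I_pow_eq (n : ℕ) : (I ^ n).im = ((if n % 4 = 1 then (1 : ℚ) else if n % 4 = 3 then -1 else 0 : ℚ) : ℝ) := by
  rw [I_pow_eq_I_pow_mod_four n]
  have h4 : n % 4 < 4 := Nat.mod_lt _ (by norm_num)
  interval_cases hn : n % 4 <;> simp [pow_succ]

/-- Cast of `absAlphaQ`. -/
theorem absAlphaQ_cast (a : ℚ) (q k : ℕ) :
    ((absAlphaQ a q k : ℚ) : ℝ) = |((a : ℝ) ^ (q - k) - (-(a : ℝ)) ^ (q - k)) * (I ^ (k + 1)).re| := by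
  rw [absAlphaQ, re_I_pow_eq]; push_cast; rfl

/-- Cast of `absBetaQ`. -/
theorem absBetaQ_cast (a : ℚ) (q k : ℕ) :
    ((absBetaQ a q k : ℚ) : ℝ) = |((a : ℝ) ^ (q - k) + (-(a : ℝ)) ^ (q - k)) * (I ^ (k + 1)).im| := by
  rw [absBetaQ, im_I_pow_eq]; push_cast; rfl

/-- **Image remainder box**: `(1/√(2a))·(|Pol|·qq^{J+1}/m₀^{2J+2} + Σ_{k≤q} q^{(k)}(a/(πm₀))^{k+1}(|α_k|RemC + |β_k|RemS))`. -/
def imgRemBox (S : ℕ) (Rs Pol QQ AP RemC RemS : MI) (a : ℚ) (q m₀ J : ℕ) : MI :=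
  (((mulRatBox ((absBox Pol).mul S (powJ S QQ (J + 1))) (1 / (m₀ : ℚ) ^ (2 * J + 2))).add
    (sumBox S (fun k ↦ (powJ S (mulRatBox AP (1 / (m₀ : ℚ))) (k + 1)).mul S
      (mulRatBox ((mulRatBox RemC (absAlphaQ a q k)).add (mulRatBox RemS (absBetaQ a q k))) (q.descFactorial k : ℚ)))
      (q + 1))).mul S Rs)

/-- **`imgRemBox ∋ ρ_re(q, m₀)`**, the remainder constant of `abs_re_image_pow_sub_collected_le` without the factor
`(m₀/m)^{E+1}` (verbatim structure; `remC`, `remS` any reals in the input boxes). -/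
theorem mem_imgRemBox (hS : 0 < S) {a : ℚ} {q m₀ : ℕ} (hm₀ : 0 < m₀) (J : ℕ)
    {Rs Pol QQ AP RemC RemS : MI} {pol remC remS : ℝ}
    (hRs : MI.mem S (1 / Real.sqrt (2 * (a : ℝ))) Rs) (hPol : MI.mem S pol Pol)
    (hQQ : MI.mem S ((a : ℝ) ^ 2 / (4 * Real.pi ^ 2)) QQ) (hAP : MI.mem S ((a : ℝ) / Real.pi) AP)
    (hRemC : MI.mem S remC RemC) (hRemS : MI.mem S remS RemS) :
    MI.mem S
      ((1 / Real.sqrt (2 * (a : ℝ))) *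
          (|pol| * (((a : ℝ) ^ 2 / (4 * π ^ 2)) ^ (J + 1) / (m₀ : ℝ) ^ (2 * J + 2))
            + ∑ k ∈ Finset.range (q + 1), (q.descFactorial k : ℝ) * ((a : ℝ) / (π * m₀)) ^ (k + 1) *
                (|((a : ℝ) ^ (q - k) - (-(a : ℝ)) ^ (q - k)) * (I ^ (k + 1)).re| * remC
                  + |((a : ℝ) ^ (q - k) + (-(a : ℝ)) ^ (q - k)) * (I ^ (k + 1)).im| * remS)))
      (imgRemBox S Rs Pol QQ AP RemC RemS a q m₀ J) := by
  have hπ : Real.pi ≠ 0 := Real.pi_ne_zero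
  have hm' : (m₀ : ℝ) ≠ 0 := by exact_mod_cast hm₀.ne'
  have h1 := mem_mulRatBox (MI.mem_mul hS (mem_absBox hPol) (mem_powJ hS hQQ (J + 1))) (1 / (m₀ : ℚ) ^ (2 * J + 2))
  have hAPm : MI.mem S ((a : ℝ) / (π * m₀)) (mulRatBox AP (1 / (m₀ : ℚ))) := by
    have := mem_mulRatBox hAP (1 / (m₀ : ℚ)); convert this using 1; push_cast; field_simp
  have h2 : MI.mem S (∑ k ∈ Finset.range (q + 1), (q.descFactorial k : ℝ) * ((a : ℝ) / (π * m₀)) ^ (k + 1) *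
        (|((a : ℝ) ^ (q - k) - (-(a : ℝ)) ^ (q - k)) * (I ^ (k + 1)).re| * remC
          + |((a : ℝ) ^ (q - k) + (-(a : ℝ)) ^ (q - k)) * (I ^ (k + 1)).im| * remS))
      (sumBox S (fun k ↦ (powJ S (mulRatBox AP (1 / (m₀ : ℚ))) (k + 1)).mul S
        (mulRatBox ((mulRatBox RemC (absAlphaQ a q k)).add (mulRatBox RemS (absBetaQ a q k))) (q.descFactorial k : ℚ)))
        (q + 1)) := by
    refine mem_sumBox (q + 1) fun k _ ↦ ?_
    have hk := MI.mem_mul hS (mem_powJ hS hAPm (k + 1))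
      (mem_mulRatBox (MI.mem_add (mem_mulRatBox hRemC (absAlphaQ a q k)) (mem_mulRatBox hRemS (absBetaQ a q k)))
        (q.descFactorial k : ℚ))
    convert hk using 1
    rw [absAlphaQ_cast, absBetaQ_cast]; push_cast; ring
  have h := MI.mem_mul hS (MI.mem_add h1 h2) hRs
  rw [imgRemBox]
  convert h using 1
  push_cast; ring

end CinfCoeff

end Summit.RiemannHypothesis.RiemannHypothesis.Theorems.WeilFormatC
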